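import Mathlib
import Literature.NumberTheory.Automorphic.ClozelAlgebraicity
import Literature.NumberTheory.Automorphic.ClozelAlgebraicitySplit
import Literature.NumberTheory.Automorphic.ClozelAlgebraicityHeckeFieldProofs
import Summits.Langlands.Langlands.Theorems.IrreducibilityBySelfDualityHeckeEigenvalueFieldBaireClosure
import Summits.Langlands.Langlands.Theorems.IrreducibilityBySelfDualityHeckeEigenvalueFieldS4
import Summits.Langlands.Langlands.Theorems.IrreducibilityBySelfDualityHeckeEigenvalueFieldConditional
import Summits.Langlands.Langlands.Theses.IrreducibilityBySelfDuality
import HarnessLib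

/-!
# Crux `HeckeEigenvalueField` (stmt-Langlands-13632), line `BaireSketch` — final closures:
# clause (ii) of Clozel's theorem ALONE gives the crux and the four-clause algebraicity fact

Supports file for the crux `Summit.Langlands.Langlands.Theses.IrreducibilityBySelfDuality.HeckeEigenvalueField`
(= `Literature.NumberTheory.Automorphic.Clozel1990_heckeEigenvalueField`, `Iff.rfl`; Clozel 1990 Thm. 3.13
in Hecke-eigenvalue form).  With (S3), UNIF (`…BaireUnif.lean`, `…StubS3.lean`), (S4) (`S4_of_stubs`,
`…S4.lean`) and the composition (`…BaireClosure.lean`) all landed, the line `BaireSketch` closes the crux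
modulo exactly one input, the existence of regular algebraic cuspidal `Aut(ℂ)`-conjugates:

* `clozel1990_heckeEigenvalueField_of_autConjugates` — existence of the conjugates ⟹ the Hecke field;
* `clozel1990_heckeEigenvalueField_of_exists_autConjugate` — hence the named fact
  `Clozel1990_exists_autConjugate` (clause (ii) of Thm. 3.13, `ClozelAlgebraicitySplit.lean`) ALONE
  implies the Hecke field `Clozel1990_heckeEigenvalueField`, the rationality-field clause (i)
  (`clozel1990_ratField_numberField_of_exists_autConjugate`) and therefore Clozel's whole four-clause
  fact `Clozel1990_regularAlgebraic` (`clozel1990_regularAlgebraic_of_exists_autConjugate`; purity (iii)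
  and CM (iv) are theorems of the tree, `Clozel1990_regularAlgebraic_holds_of`);
* `HeckeEigenvalueField_of_exists_autConjugate` — the route decl BY NAME, conditionally on
  `Clozel1990_exists_autConjugate` (unproved in the tree for `n ≥ 2`: it is the `σ`-linear transport of
  structure on cuspidal cohomology, Clozel §3.5; `n = 1`: `exists_cuspidal_isAutConjugate_rank_one`);
* `clozel1990_heckeEigenvalueField_of_clozel1990_regularAlgebraic` — the four-clause fact gives the crux
  (only its clause (ii) is used), correcting the non-implication recorded in the docstring of
  `Clozel1990_heckeEigenvalueField`.

References: L. Clozel, *Motifs et formes automorphes*, Ann Arbor 1988 (1990), Thm. 3.13, §3.5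
[Clozel1990]; S. Patrikis, *Variations on a theorem of Tate*, Mem. AMS 258 (2019), Thm. 3.2.1 [Patrikis2019].
-/

set_option linter.dupNamespace false -- project-wide: `Summit.Langlands.Langlands` is the mandated namespace

noncomputable section

open scoped Classical
open Filter NumberField IsDedekindDomain
open Literature.NumberTheory.Automorphic

namespace Summit.Langlands.Langlands.Theorems.HeckeEigenvalueField.Baire

/-- **The line's reduction of the crux to clause (ii)**: the Hecke field
(`Clozel1990_heckeEigenvalueField`, definitionally the crux) from the existence, for every cuspidal
regular algebraic `π` and every `σ ∈ Aut(ℂ)`, of a cuspidal regular algebraic `σ`-conjugate at almost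
all places — (S3), (S4) and UNIF being theorems. [folklore] -/
theorem clozel1990_heckeEigenvalueField_of_autConjugates
    (hA : ∀ (n : ℕ) (K : Type) [Field K] [NumberField K]
      (hcpt : isCompact_glFiniteIntegralLevel n K)
      (π : CuspidalAutomorphicRepData n K hcpt), π.1.IsRegularAlgebraic → ∀ σ : ℂ ≃ₐ[ℚ] ℂ,
        ∃ π' : CuspidalAutomorphicRepData n K hcpt, IsAutConjugate σ π.1 π'.1 ∧ π'.1.IsRegularAlgebraic) :
    Clozel1990_heckeEigenvalueField :=
  clozel1990_heckeEigenvalueField_of_S4_autConjugates S4_of_stubs hA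

/-- **Conditional form, clause (ii) alone**: the crux (stated as the definitionally equal named fact
`Clozel1990_heckeEigenvalueField`) from (S3) + (S4) + the named fact `Clozel1990_exists_autConjugate`
(existence of the cuspidal `Aut(ℂ)`-conjugates, clause (ii) of Clozel's Thm. 3.13).
[cite: Clozel1990, Thm. 3.13] -/
theorem clozel1990_heckeEigenvalueField_of_exists_autConjugate (h : Clozel1990_exists_autConjugate) :
    Clozel1990_heckeEigenvalueField :=
  clozel1990_heckeEigenvalueField_of_autConjugates (autConjugates_of_exists_autConjugate h)

/-- **The route decl BY NAME, conditionally on clause (ii) of Clozel's theorem**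
(`Clozel1990_exists_autConjugate`, the one open stub of line `BaireSketch`): composition of
`clozel1990_heckeEigenvalueField_of_exists_autConjugate` with the `Iff.rfl` identification
`route_heckeEigenvalueField_of_clozel1990`. [cite: Clozel1990, Thm. 3.13] -/
theorem HeckeEigenvalueField_of_exists_autConjugate (h : Clozel1990_exists_autConjugate) :
    Summit.Langlands.Langlands.Theses.IrreducibilityBySelfDuality.HeckeEigenvalueField :=
  route_heckeEigenvalueField_of_clozel1990 (clozel1990_heckeEigenvalueField_of_exists_autConjugate h)

/-- **Clause (ii) alone gives clause (i)**: under `Clozel1990_exists_autConjugate` the rationality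
field `ℚ(π_f) = ratField π` of every cuspidal regular algebraic `π` is a number field
(`Clozel1990_ratField_numberField`), since `ratField π` sits inside the Hecke field
(`Clozel1990_heckeEigenvalueField.finiteDimensional_ratField`). [cite: Clozel1990, Thm. 3.13] -/
theorem clozel1990_ratField_numberField_of_exists_autConjugate (h : Clozel1990_exists_autConjugate) :
    Clozel1990_ratField_numberField :=
  fun _ _ _ _ _ π hπ =>
    (clozel1990_heckeEigenvalueField_of_exists_autConjugate h).finiteDimensional_ratField π hπ

/-- **Clause (ii) alone gives Clozel's whole four-clause algebraicity fact**
`Clozel1990_regularAlgebraic` ((i) by `clozel1990_ratField_numberField_of_exists_autConjugate`,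
(iii) purity and (iv) CM are theorems of the tree: `Clozel1990_regularAlgebraic_holds_of`).
[cite: Clozel1990, Thm. 3.13] -/
theorem clozel1990_regularAlgebraic_of_exists_autConjugate (h : Clozel1990_exists_autConjugate) :
    Clozel1990_regularAlgebraic :=
  Clozel1990_regularAlgebraic_holds_of (clozel1990_ratField_numberField_of_exists_autConjugate h) h

/-- **Conditional form (four-clause fact)**: the crux from the vendored named fact
`Clozel1990_regularAlgebraic` (only its clause (ii) is used). [cite: Clozel1990, Thm. 3.13] -/
theorem clozel1990_heckeEigenvalueField_of_clozel1990_regularAlgebraic (h : Clozel1990_regularAlgebraic) :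
    Clozel1990_heckeEigenvalueField :=
  clozel1990_heckeEigenvalueField_of_autConjugates (autConjugates_of_clozel1990 h)

/-- **The route decl BY NAME from the four-clause fact `Clozel1990_regularAlgebraic`** (registered
stub `HeckeEigenvalueField_of_clozel1990_regularAlgebraic` of the line: the conditional closure of the
crux modulo clause (ii) of the vendored fact), refuting in particular the non-implication
"`Clozel1990_regularAlgebraic` does not imply the Hecke field" recorded in the docstring of
`Clozel1990_heckeEigenvalueField`. [cite: Clozel1990, Thm. 3.13] -/
theorem HeckeEigenvalueField_of_clozel1990_regularAlgebraic (h : Clozel1990_regularAlgebraic) :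
    Summit.Langlands.Langlands.Theses.IrreducibilityBySelfDuality.HeckeEigenvalueField :=
  route_heckeEigenvalueField_of_clozel1990 (clozel1990_heckeEigenvalueField_of_clozel1990_regularAlgebraic h)

end Summit.Langlands.Langlands.Theorems.HeckeEigenvalueField.Baire

end
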